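/-
Copyright (c) 2026 the pub-hodgecm-mathlib formalisation cell (harness21).  Prover seat hodgecm-mathlib-LH4-p09 (g2), req620 Track A «(D-RAM) FOUR-FRAME» squad
(unit U3_Laws, RULING (R-17) «NI2 ⊕ MS», registered stub `stub_U3_normIndexTwo`): the GRADED NORM STEPS of Serre's computation `[U_F : N U_E] = 2`
for a totally ramified quadratic extension, in the one-field datum currency.  2026-09-03.
-/
import Literature.NumberTheory.LocalFields.WildQuadraticDatumTrace          -- ★ datum toolkit: `v_varpi_pow`, `map_varpi_ne`, `even_log_v_of_fixed`, `two_ne_zero`, `v_add_map_le_exp` (trace images)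
import Literature.NumberTheory.LocalFields.WildQuadraticNormsNearOne         -- ★ `exists_valued_mul_self_sub_lt_one_of_finite_residueField` (every residue is a square, char 2)
import Mathlib.GroupTheory.Index
import Mathlib.Algebra.CharP.Two
import HarnessLib

/-!
# The graded norm maps of a RAMIFIED QUADRATIC DATUM below and at the break: `N(1 + yϖⁿ) = 1 + y·Tr(ϖⁿ) + y²·(ϖσϖ)ⁿ` for `σ`-fixed `y`
# (Serre, *Local Fields* V §3 Prop. 5 (i)–(iii) for `ℓ = p = 2`: levels `n ≤ d − 2` are ONTO, the break level `n = d − 1` has image of index `≤ 2`)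

Topic `NumberTheory/LocalFields`; namespace `Literature.NumberTheory.LocalFields.WildQuadraticDatum` (the one-field datum of ★ `WildQuadraticDatumTrace`:
`σ` an involution of a discretely valued field `K` with `v ∘ σ = v`, non-zero `σ`-fixed elements of even valuation, `ϖ` a uniformiser, `|ϖ − σϖ| = |ϖ|^d`,
`|2| = |ϖ|^t`; the fixed field `F = K^σ` is never a type).  THEOREMS ONLY (no definition, no instance, no notation, no named fact, no `sorry`).
Cell `pub/hodgecm-mathlib` (D-0151), crux H413 = `stmt-HodgeConjecture-24833`; road «(D-RAM) FOUR-FRAME», unit U3_Laws, LEAD ruling (R-17): the §S heads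
`stub_U3_stableLaw_RP ∕ _RU` reduce BY NAME (★ `F0P3cDyRamStableLawOfModelSum`) to (NI2) «local norm index two with a unit representative» + (MS); this file is
the ENGINE of (NI2) at a WILD place (`|2| < 1`), the sequel `WildQuadraticDatumNormIndexTwo` assembles (NI2) itself (wild by induction on the level + ★
`exists_mul_map_eq_of_isRamifiedQuadraticDatum` for the deep levels; tame by ★ `RamifiedQuadraticNorm.exists_mul_map_eq_or_eq_mul`).

THE MATHEMATICS (Serre V §3, `G = {1, σ}`, break `i_G(σ) − 1 = d − 1`, `ψ(n) = n` for `n ≤ d − 1`).  Write `π := ϖ·σϖ` (a `σ`-fixed uniformiser of `F`, `|π| = |ϖ|²`) and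
`Aₙ := ϖⁿ + σ(ϖⁿ) = Tr(ϖⁿ)`.  For `σ`-FIXED `y` one has the exact identity `N(1 + y·ϖⁿ) = (1 + yϖⁿ)(1 + y·σϖⁿ) = 1 + y·Aₙ + y²·πⁿ` (§1), and the trace images
★ `v_add_map_le_exp` (`Tr 𝔭_E^j ⊆ 𝔭_F^{⌊(j+d)∕2⌋}`, Serre III §3 Prop. 7) give `|Aₙ| ≤ |π|^{n+1}` for `n ≤ d − 2` and `|A_{d−1}| ≤ |π|^{d−1}`.  Hence, for a `σ`-fixed unit
`w` with `|w − 1| ≤ |π|ⁿ`, writing `w − 1 = W·πⁿ` and `Aₙ = λ·πⁿ` (`W, λ` fixed integers):  `w − N(1 + yϖⁿ) = −πⁿ·(y² + λy − W)`.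
* BELOW THE BREAK (`n ≤ d − 2`, §2): `|λ| < 1`, and `y² ≡ W (mod 𝔪)` is solvable by a FIXED integer `y` (every residue of the finite residue field of characteristic `2` is a
  square, ★ `exists_valued_mul_self_sub_lt_one_of_finite_residueField`; every integer is within `|ϖ|` of a fixed one, §1); a fixed element of valuation `< 1` has valuation
  `≤ |π|`, so `|w − N(1 + yϖⁿ)| ≤ |π|^{n+1}`: THE GRADED NORM MAP IS ONTO (Serre V §3 Prop. 5 (ii), `ξ ↦ ξ^p`).
* AT THE BREAK (`n = d − 1 ≥ 1`, §3): the residue map `ȳ ↦ ȳ² + λ̄ȳ` is ADDITIVE on the finite residue field `𝓀` of characteristic `2` with kernel `{0, λ̄}`, so its image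
  has index `≤ 2` in `(𝓀, +)` (§0, pure finite-group counting: `|ker|·[𝓀 : ker] = |𝓀|`, `[𝓀 : ker] = |im|`); ONE fixed integer `κ` (a lift of a representative of the other
  coset) therefore serves every `W`: `y² + λy ≡ W` or `≡ W + κ (mod 𝔪)` for some fixed `y`, i.e. `|w − N(1+yϖⁿ)| ≤ |π|^{d}` or `|c·w − N(1+yϖⁿ)| ≤ |π|^{d}` with the SINGLE
  fixed one-unit `c := 1 + κ·π^{d−1}` (Serre V §3 Prop. 5 (iii), `ξ ↦ ξ^p − η^{p−1}ξ`, cokernel of order `p = 2`).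
No completeness is used in this file (only `[Finite 𝓀[K]]` and `|2| < 1`); nothing printed is asserted — elementary valuation algebra.  HONEST LABEL: HC_CM is proved only
modulo the 7 printed citations (2 remaining named inputs: hLiu418 = stmt-HodgeConjecture-24832, h413 = stmt-HodgeConjecture-24833) until rung 0 closes; count-neutral.

* §0 `exists_forall_sq_add_mul_eq_or` (finite field of characteristic two: the image of `y ↦ y² + l·y` has index `≤ 2`).
* §1 bookkeeping: `v_le_exp_of_fixed_of_v_lt` (fixed + `v < exp 2m` ⇒ `v ≤ exp(2m−2)`), `exists_fixed_v_sub_le` (fixed approximation of integers),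
  `mul_map_mul_map` ∕ `map_mul_map` (norms multiply, norms are fixed), `v_normVarpi_pow` (`|πⁿ| = exp(−2n)`), `one_add_mul_mul_map` (the norm identity),
  `v_eq_one_of_v_mul_map_eq_one` (`|zσz| = 1 ⇒ |z| = 1`), `mem_maximalIdeal_iff_v_lt_one`, `residue_eq_of_v_sub_lt_one`, `exists_fixed_residue_dichotomy`.
* §2 `exists_norm_approx_below_break` (levels `n ≤ d − 2`).   §3 `exists_norm_approx_at_break` (the break level, one `c` for all `w`).

## References
* [Serre1979] J.-P. Serre, *Local Fields*, GTM 67 (1979): Ch. V §3 Prop. 5 and Cor. 3 pp. 85–87 (the graded norm maps of a totally ramified cyclic extension of prime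
  degree), Ch. III §3 Prop. 7 (trace images), Ch. XV §2 (norm groups).
* [NeukirchANT1999] J. Neukirch, *Algebraic Number Theory* (1999): Ch. V (1.2)–(1.3) (the local norm index).
-/

set_option autoImplicit false

open WithZero
open scoped Valued

namespace Literature.NumberTheory.LocalFields.WildQuadraticDatum

/-! ## §0 Finite fields of characteristic two: the image of `y ↦ y² + l·y` has index at most two -/

/-- **INDEX `≤ 2` OF `y ↦ y² + l·y` ON A FINITE FIELD OF CHARACTERISTIC TWO**: there is ONE `κ` such that every `w` is `y² + l·y` or `y² + l·y − κ` for some `y`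
(the map is additive with kernel `{0, l}`; `|ker|·|im| = |k|` forces `[k : im] ≤ 2`).  This is the residue-field content of Serre's break-level norm map
`ξ ↦ ξ^p − η^{p−1}ξ` for `p = 2`. [cite: Serre1979, Ch. V §3 Prop. 5 (iii)] -/
theorem exists_forall_sq_add_mul_eq_or {k : Type*} [Field k] [Finite k] [CharP k 2] (l : k) :
    ∃ κ : k, ∀ w : k, ∃ y : k, y * y + l * y = w ∨ y * y + l * y = w + κ := by
  classical
  -- the additive map `y ↦ y² + l·y` (characteristic two)
  let φ : k →+ k :=
    { toFun := fun y => y * y + l * y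
      map_zero' := by simp
      map_add' := fun a b => by
        have h2 : (2 : k) = 0 := CharTwo.two_eq_zero
        linear_combination (a * b) * h2 }
  have hφ : ∀ y, φ y = y * y + l * y := fun _ => rfl
  by_cases hl : l = 0
  · -- Frobenius is onto
    refine ⟨0, fun w => ?_⟩
    have hinj : Function.Injective φ := by
      intro a b hab
      rw [hφ, hφ, hl, zero_mul, add_zero, zero_mul, add_zero] at hab
      have h : (a - b) * (a - b) = 0 := by
        have h2 : (2 : k) = 0 := CharTwo.two_eq_zero
        linear_combination hab + (b * b - a * b) * h2
      exact sub_eq_zero.1 (mul_self_eq_zero.1 h)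
    obtain ⟨y, hy⟩ := Finite.surjective_of_injective hinj w
    exact ⟨y, Or.inl (by rw [← hφ, hy])⟩
  · -- kernel `{0, l}` has two elements, so the image has index two
    have hker : ∀ y, y ∈ φ.ker ↔ y = 0 ∨ y = l := by
      intro y
      rw [AddMonoidHom.mem_ker, hφ]
      constructor
      · intro h
        have h' : y * (y + l) = 0 := by linear_combination h
        rcases mul_eq_zero.1 h' with h0 | h0
        · exact Or.inl h0
        · right
          have h2 : (2 : k) = 0 := CharTwo.two_eq_zero
          linear_combination h0 - l * h2
      · rintro (h | h)
        · rw [h]; simp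
        · rw [h]
          have h2 : (2 : k) = 0 := CharTwo.two_eq_zero
          linear_combination (l * l) * h2
    have hcard : Nat.card φ.ker = 2 := by
      rw [Nat.card_eq_two_iff]
      refine ⟨⟨0, (hker 0).2 (Or.inl rfl)⟩, ⟨l, (hker l).2 (Or.inr rfl)⟩, fun h => hl (Subtype.ext_iff.1 h).symm, ?_⟩
      ext ⟨y, hy⟩
      simp only [Set.mem_insert_iff, Set.mem_singleton_iff, Set.mem_univ, iff_true, Subtype.mk.injEq]
      rcases (hker y).1 hy with h | h
      · exact Or.inl h
      · exact Or.inr h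
    have hidx : φ.range.index = 2 := by
      have h1 := φ.ker.card_mul_index
      rw [AddSubgroup.index_ker, hcard] at h1
      have h2 := φ.range.card_mul_index
      have hpos : 0 < Nat.card φ.range := Nat.card_pos
      have : Nat.card φ.range * φ.range.index = Nat.card φ.range * 2 := by rw [h2, ← h1, mul_comm]
      exact Nat.eq_of_mul_eq_mul_left hpos this
    obtain ⟨κ, -, hκ⟩ := AddSubgroup.index_eq_two_iff_exists_notMem_and.1 hidx
    refine ⟨κ, fun w => ?_⟩
    rcases hκ w with h | h
    · obtain ⟨y, hy⟩ := h
      exact ⟨y, Or.inr (by rw [← hφ, hy])⟩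
    · obtain ⟨y, hy⟩ := h
      exact ⟨y, Or.inl (by rw [← hφ, hy])⟩

variable {K : Type*} [Field K] [Valued K ℤᵐ⁰] {σ : K →+* K} {ϖ : K} {d t : ℕ}

/-! ## §1 Bookkeeping in the datum: fixed valuations, fixed approximation, the norm identity, residues -/

/-- A `σ`-FIXED element of valuation `< exp(2m)` has valuation `≤ exp(2m − 2)` (fixed valuations are the EVEN powers). [cite: Serre1979, Ch. V §3 Prop. 5] -/
theorem v_le_exp_of_fixed_of_v_lt (hfix : ∀ x : K, σ x = x → x ≠ 0 → ∃ n : ℤ, Valued.v x = exp (2 * n))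
    {x : K} (hσx : σ x = x) {m : ℤ} (hx : Valued.v x < exp (2 * m)) : Valued.v x ≤ exp (2 * m - 2) := by
  rcases eq_or_ne x 0 with rfl | hx0
  · rw [map_zero]; exact zero_le
  obtain ⟨n, hn⟩ := hfix x hσx hx0
  rw [hn, exp_lt_exp] at hx
  rw [hn, exp_le_exp]
  omega

/-- **FIXED APPROXIMATION OF INTEGERS** (`𝒪_E = 𝒪_F ⊕ 𝒪_F·ϖ`, ★ `exists_fixed_coords_of_map_ne` + ★ `v_fixed_add_fixed_mul_le_one_iff`): every `x` with `|x| ≤ 1` is within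
`|ϖ|` of a `σ`-FIXED integer `a` (`x = a + bϖ`, `|a|, |b| ≤ 1`).  In particular `σ` is residually trivial and every residue has a fixed representative. [cite: Serre1979, Ch. I §6 Prop. 18] -/
theorem exists_fixed_v_sub_le (hσ : ∀ x, σ (σ x) = x) (hfix : ∀ x : K, σ x = x → x ≠ 0 → ∃ n : ℤ, Valued.v x = exp (2 * n))
    (hϖ : Valued.v ϖ = exp (-1 : ℤ)) (hd : Valued.v (ϖ - σ ϖ) = Valued.v ϖ ^ d) {x : K} (hx : Valued.v x ≤ 1) :
    ∃ a : K, σ a = a ∧ Valued.v a ≤ 1 ∧ Valued.v (x - a) ≤ exp (-1 : ℤ) := by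
  obtain ⟨a, b, ha, hb, hxab⟩ := exists_fixed_coords_of_map_ne hσ (map_varpi_ne hϖ hd) x
  have hfix' := even_log_v_of_fixed hfix
  obtain ⟨ha1, hb1⟩ := (v_fixed_add_fixed_mul_le_one_iff hfix' hϖ ha hb).1 (hxab ▸ hx)
  refine ⟨a, ha, ha1, ?_⟩
  rw [hxab, add_sub_cancel_left, map_mul, hϖ]
  calc Valued.v b * exp (-1 : ℤ) ≤ 1 * exp (-1 : ℤ) := mul_le_mul_left hb1 _
    _ = exp (-1 : ℤ) := one_mul _

omit [Valued K ℤᵐ⁰] in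
/-- Norms multiply: `(z₁σz₁)(z₂σz₂) = (z₁z₂)σ(z₁z₂)` (the norm map `N z = z·σz` is multiplicative). [cite: Serre1979, Ch. V §3 Prop. 5] -/
theorem mul_map_mul_map (z₁ z₂ : K) : (z₁ * σ z₁) * (z₂ * σ z₂) = (z₁ * z₂) * σ (z₁ * z₂) := by
  rw [map_mul]; ring

omit [Valued K ℤᵐ⁰] in
/-- Norms are `σ`-fixed: `σ(zσz) = zσz` (`N` lands in `F = K^σ`). [cite: Serre1979, Ch. V §3 Prop. 5] -/
theorem map_mul_map (hσ : ∀ x, σ (σ x) = x) (z : K) : σ (z * σ z) = z * σ z := by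
  rw [map_mul, hσ, mul_comm]

/-- `|(ϖσϖ)ⁿ| = exp(−2n)`: `π = ϖσϖ` is a `σ`-fixed uniformiser of `F = K^σ`. [cite: Serre1979, Ch. I §6 Prop. 18] -/
theorem v_normVarpi_pow (hvσ : ∀ a, Valued.v (σ a) = Valued.v a) (hϖ : Valued.v ϖ = exp (-1 : ℤ)) (n : ℕ) :
    Valued.v ((ϖ * σ ϖ) ^ n) = exp (-(2 * (n : ℤ))) := by
  rw [map_pow, map_mul, hvσ, hϖ, ← exp_add, ← exp_nsmul]
  congr 1
  simp only [nsmul_eq_mul]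
  ring

omit [Valued K ℤᵐ⁰] in
/-- **THE NORM IDENTITY**: for `σ`-FIXED `y`, `N(1 + y·ϖⁿ) = (1 + yϖⁿ)·σ(1 + yϖⁿ) = 1 + y·(ϖⁿ + σϖⁿ) + y²·(ϖσϖ)ⁿ` — trace term plus norm term, exactly.
[cite: Serre1979, Ch. V §3 Prop. 4] -/
theorem one_add_mul_mul_map {y : K} (hσy : σ y = y) (n : ℕ) :
    (1 + y * ϖ ^ n) * σ (1 + y * ϖ ^ n) = 1 + y * (ϖ ^ n + σ (ϖ ^ n)) + y * y * (ϖ * σ ϖ) ^ n := by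
  rw [map_add, map_one, map_mul, hσy, map_pow, mul_pow]
  ring

/-- `|zσz| = 1 ⇒ |z| = 1` (`v∘σ = v`: the norm of a non-unit is a non-unit). [cite: Serre1979, Ch. V §3 Prop. 5] -/
theorem v_eq_one_of_v_mul_map_eq_one (hvσ : ∀ a, Valued.v (σ a) = Valued.v a) {z : K} (hz : Valued.v (z * σ z) = 1) : Valued.v z = 1 := by
  rw [map_mul, hvσ] at hz
  have hz0 : Valued.v z ≠ 0 := fun h => by rw [h, mul_zero] at hz; exact zero_ne_one hz
  rw [← exp_log hz0, ← exp_add, ← exp_zero, exp_inj] at hz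
  rw [← exp_log hz0, ← exp_zero]
  congr 1
  omega

/-- `x ∈ 𝓂[K] ⟺ |x| < 1` for `x ∈ 𝒪[K]` (the maximal ideal of the valuation ring). [cite: Serre1979, Ch. II §1] -/
theorem mem_maximalIdeal_iff_v_lt_one (x : 𝒪[K]) : x ∈ 𝓂[K] ↔ Valued.v (x : K) < 1 := by
  rw [Valued.maximalIdeal, IsLocalRing.mem_maximalIdeal, mem_nonunits_iff, Valuation.Integer.not_isUnit_iff_valuation_lt_one]

/-- Integers at distance `< 1` have the same residue (`𝒪 → 𝓀 = 𝒪∕𝓂`). [cite: Serre1979, Ch. II §1] -/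
theorem residue_eq_of_v_sub_lt_one (x y : 𝒪[K]) (h : Valued.v ((x : K) - y) < 1) :
    IsLocalRing.residue 𝒪[K] x = IsLocalRing.residue 𝒪[K] y := by
  rw [← sub_eq_zero, ← map_sub, IsLocalRing.residue_eq_zero_iff]
  exact (mem_maximalIdeal_iff_v_lt_one _).2 (by exact_mod_cast h)

/-- **THE BREAK-LEVEL RESIDUE DICHOTOMY WITH FIXED SOLUTIONS**: residue field finite of characteristic `2` (`|2| < 1`), `l` an integer; there is ONE `σ`-fixed integer `κ` such that for
every integer `W` some `σ`-FIXED integer `a` solves `a² + l·a ≡ W` or `a² + l·a ≡ W + κ (mod 𝔪)` — §0 in the residue field, lifted, then moved to fixed representatives by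
`exists_fixed_v_sub_le`. [cite: Serre1979, Ch. V §3 Prop. 5 (iii)] -/
theorem exists_fixed_residue_dichotomy [Finite 𝓀[K]] (hσ : ∀ x, σ (σ x) = x) (hfix : ∀ x : K, σ x = x → x ≠ 0 → ∃ n : ℤ, Valued.v x = exp (2 * n))
    (hϖ : Valued.v ϖ = exp (-1 : ℤ)) (hd : Valued.v (ϖ - σ ϖ) = Valued.v ϖ ^ d) (h2v : Valued.v (2 : K) < 1) {l : K} (hl : Valued.v l ≤ 1) :
    ∃ κ : K, σ κ = κ ∧ Valued.v κ ≤ 1 ∧ ∀ W : K, Valued.v W ≤ 1 →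
      ∃ a : K, σ a = a ∧ Valued.v a ≤ 1 ∧ (Valued.v (a * a + l * a - W) < 1 ∨ Valued.v (a * a + l * a - (W + κ)) < 1) := by
  have hϖ1 : exp (-1 : ℤ) < (1 : ℤᵐ⁰) := by rw [← exp_zero, exp_lt_exp]; norm_num
  -- the residue field has characteristic two
  have h2M : (2 : 𝒪[K]) ∈ 𝓂[K] := (mem_maximalIdeal_iff_v_lt_one _).2 (by exact_mod_cast h2v)
  haveI : CharP 𝓀[K] 2 := by
    refine CharTwo.of_one_ne_zero_of_two_eq_zero one_ne_zero ?_
    have h := (IsLocalRing.residue_eq_zero_iff (2 : 𝒪[K])).2 h2M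
    rwa [map_ofNat] at h
  set lO : 𝒪[K] := ⟨l, (Valuation.mem_integer_iff _ _).2 hl⟩ with hlO
  obtain ⟨κbar, hκbar⟩ := exists_forall_sq_add_mul_eq_or (IsLocalRing.residue 𝒪[K] lO)
  obtain ⟨κO, hκO⟩ := IsLocalRing.residue_surjective κbar
  obtain ⟨κ, hσκ, hκ1, hκapprox⟩ := exists_fixed_v_sub_le hσ hfix hϖ hd (x := (κO : K)) κO.2
  set κO' : 𝒪[K] := ⟨κ, (Valuation.mem_integer_iff _ _).2 hκ1⟩ with hκO'
  have hκres : IsLocalRing.residue 𝒪[K] κO' = κbar := by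
    rw [← hκO]
    exact (residue_eq_of_v_sub_lt_one κO κO' (lt_of_le_of_lt hκapprox hϖ1)).symm
  refine ⟨κ, hσκ, hκ1, fun W hW => ?_⟩
  set WO : 𝒪[K] := ⟨W, (Valuation.mem_integer_iff _ _).2 hW⟩ with hWO
  obtain ⟨ybar, hybar⟩ := hκbar (IsLocalRing.residue 𝒪[K] WO)
  obtain ⟨yO, hyO⟩ := IsLocalRing.residue_surjective ybar
  obtain ⟨a, hσa, ha1, haapprox⟩ := exists_fixed_v_sub_le hσ hfix hϖ hd (x := (yO : K)) yO.2
  set aO : 𝒪[K] := ⟨a, (Valuation.mem_integer_iff _ _).2 ha1⟩ with haO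
  have hares : IsLocalRing.residue 𝒪[K] aO = ybar := by
    rw [← hyO]
    exact (residue_eq_of_v_sub_lt_one yO aO (lt_of_le_of_lt haapprox hϖ1)).symm
  refine ⟨a, hσa, ha1, ?_⟩
  rcases hybar with h | h
  · left
    have hmem : aO * aO + lO * aO - WO ∈ 𝓂[K] := by
      rw [← IsLocalRing.residue_eq_zero_iff, map_sub, map_add, map_mul, map_mul, hares, h, sub_self]
    have := (mem_maximalIdeal_iff_v_lt_one _).1 hmem
    exact_mod_cast this
  · right
    have hmem : aO * aO + lO * aO - (WO + κO') ∈ 𝓂[K] := by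
      rw [← IsLocalRing.residue_eq_zero_iff, map_sub, map_add, map_add, map_mul, map_mul, hares, hκres, h, sub_self]
    have := (mem_maximalIdeal_iff_v_lt_one _).1 hmem
    exact_mod_cast this

/-! ## §2 Below the break: the graded norm map at level `n ≤ d − 2` is onto -/

/-- **BELOW THE BREAK THE GRADED NORM MAP IS ONTO** (Serre V §3 Prop. 5 (ii), `ξ ↦ ξ²` on the finite residue field of characteristic `2`): in the ramified quadratic datum with
`|2| < 1`, for `n + 2 ≤ d` and a `σ`-fixed unit `w` with `|w − 1| ≤ exp(−2n)` there is `z` with `|z| = 1` and `|w − zσz| ≤ exp(−(2n + 2))` — namely `z = 1 + y·ϖⁿ` with a FIXED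
integer `y`, `y² ≡ (w − 1)∕(ϖσϖ)ⁿ (mod 𝔪)`; the trace term `y·Tr(ϖⁿ)` is negligible by ★ `v_add_map_le_exp` (`Tr 𝔭_E^n ⊆ 𝔭_F^{n+1}` for `n ≤ d − 2`).
[cite: Serre1979, Ch. V §3 Prop. 5 (ii)] [cite: NeukirchANT1999, Ch. V (1.2)] -/
theorem exists_norm_approx_below_break [Finite 𝓀[K]] (hσ : ∀ x, σ (σ x) = x) (hvσ : ∀ a, Valued.v (σ a) = Valued.v a)
    (hfix : ∀ x : K, σ x = x → x ≠ 0 → ∃ n : ℤ, Valued.v x = exp (2 * n)) (hϖ : Valued.v ϖ = exp (-1 : ℤ))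
    (hd : Valued.v (ϖ - σ ϖ) = Valued.v ϖ ^ d) (ht : Valued.v (2 : K) = Valued.v ϖ ^ t) (h2v : Valued.v (2 : K) < 1)
    {n : ℕ} (hn : n + 2 ≤ d) {w : K} (hσw : σ w = w) (hw1 : Valued.v w = 1) (hw : Valued.v (w - 1) ≤ exp (-(2 * (n : ℤ)))) :
    ∃ z : K, Valued.v z = 1 ∧ Valued.v (w - z * σ z) ≤ exp (-(2 * (n : ℤ) + 2)) := by
  have hϖ1 : exp (-1 : ℤ) < (1 : ℤᵐ⁰) := by rw [← exp_zero, exp_lt_exp]; norm_num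
  -- `π := ϖσϖ`, `πⁿ`
  have hπn : Valued.v ((ϖ * σ ϖ) ^ n) = exp (-(2 * (n : ℤ))) := v_normVarpi_pow hvσ hϖ n
  have hπn0 : (ϖ * σ ϖ) ^ n ≠ 0 := (Valuation.ne_zero_iff _).1 (by rw [hπn]; exact exp_ne_zero)
  have hσπn : σ ((ϖ * σ ϖ) ^ n) = (ϖ * σ ϖ) ^ n := by rw [map_pow, map_mul_map hσ]
  -- the trace term `Aₙ = ϖⁿ + σϖⁿ`, `|Aₙ| ≤ exp(−2(n+1))`
  have hA : Valued.v (ϖ ^ n + σ (ϖ ^ n)) ≤ exp (-(2 * ((n : ℤ) + 1))) :=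
    v_add_map_le_exp hσ hfix hϖ hd ht (x := ϖ ^ n) (j := n) (m := n + 1)
      (by rw [map_pow, v_varpi_pow hϖ]) (by omega)
  have hσA : σ (ϖ ^ n + σ (ϖ ^ n)) = ϖ ^ n + σ (ϖ ^ n) := map_add_map_eq_self hσ _
  -- `W := (w − 1)∕πⁿ`, `λ := Aₙ∕πⁿ`
  set W : K := (w - 1) / (ϖ * σ ϖ) ^ n with hWdef
  set lam : K := (ϖ ^ n + σ (ϖ ^ n)) / (ϖ * σ ϖ) ^ n with hlamdef
  have hσW : σ W = W := by rw [hWdef, map_div₀, map_sub, map_one, hσw, hσπn]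
  have hσlam : σ lam = lam := by rw [hlamdef, map_div₀, hσA, hσπn]
  have hW1 : Valued.v W ≤ 1 := by
    rw [hWdef, map_div₀, hπn, div_le_iff₀ (by exact exp_pos), one_mul]; exact hw
  have hlam1 : Valued.v lam < 1 := by
    rw [hlamdef, map_div₀, hπn, div_lt_iff₀ (by exact exp_pos), one_mul]
    exact lt_of_le_of_lt hA (by rw [exp_lt_exp]; omega)
  -- a fixed integer `a` with `a² ≡ W (mod 𝔪)`
  obtain ⟨x, hx1, hxW⟩ := exists_valued_mul_self_sub_lt_one_of_finite_residueField h2v W hW1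
  obtain ⟨a, hσa, ha1, hxa⟩ := exists_fixed_v_sub_le hσ hfix hϖ hd hx1
  have hkey : Valued.v (a * a + lam * a - W) < 1 := by
    have h1 : Valued.v ((a - x) * (a + x)) < 1 := by
      rw [map_mul]
      calc Valued.v (a - x) * Valued.v (a + x) ≤ Valued.v (a - x) * 1 :=
            mul_le_mul_right (Valued.v.map_add_le ha1 hx1) _
        _ < 1 := by
            rw [mul_one, ← neg_sub, Valuation.map_neg]; exact lt_of_le_of_lt hxa hϖ1
    have h2 : Valued.v (lam * a) < 1 := by
      rw [map_mul]
      calc Valued.v lam * Valued.v a ≤ Valued.v lam * 1 := mul_le_mul_right ha1 _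
        _ < 1 := by rw [mul_one]; exact hlam1
    have : a * a + lam * a - W = (x * x - W) + (a - x) * (a + x) + lam * a := by ring
    rw [this]
    exact Valued.v.map_add_lt (Valued.v.map_add_lt hxW h1) h2
  have hkey' : Valued.v (a * a + lam * a - W) ≤ exp (-2 : ℤ) := by
    have hσk : σ (a * a + lam * a - W) = a * a + lam * a - W := by
      rw [map_sub, map_add, map_mul, map_mul, hσa, hσlam, hσW]
    have := v_le_exp_of_fixed_of_v_lt hfix hσk (m := 0) (by rw [mul_zero, exp_zero]; exact hkey)
    simpa using this
  -- `z := 1 + a·ϖⁿ`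
  refine ⟨1 + a * ϖ ^ n, ?_, ?_⟩
  · -- `|N z| = 1`, hence `|z| = 1`
    apply v_eq_one_of_v_mul_map_eq_one hvσ
    have hdiff : w - (1 + a * ϖ ^ n) * σ (1 + a * ϖ ^ n) = -((ϖ * σ ϖ) ^ n * (a * a + lam * a - W)) := by
      rw [one_add_mul_mul_map hσa n, hlamdef, hWdef]
      field_simp
      ring
    have hlt : Valued.v (w - (1 + a * ϖ ^ n) * σ (1 + a * ϖ ^ n)) < Valued.v w := by
      rw [hdiff, Valuation.map_neg, map_mul, hπn, hw1]
      calc exp (-(2 * (n : ℤ))) * Valued.v (a * a + lam * a - W) ≤ exp (-(2 * (n : ℤ))) * exp (-2 : ℤ) :=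
            mul_le_mul_right hkey' _
        _ < 1 := by rw [← exp_add, ← exp_zero, exp_lt_exp]; omega
    rw [← hw1]
    apply Valuation.map_eq_of_sub_lt
    rw [← neg_sub, Valuation.map_neg]
    exact hlt
  · have hdiff : w - (1 + a * ϖ ^ n) * σ (1 + a * ϖ ^ n) = -((ϖ * σ ϖ) ^ n * (a * a + lam * a - W)) := by
      rw [one_add_mul_mul_map hσa n, hlamdef, hWdef]
      field_simp
      ring
    rw [hdiff, Valuation.map_neg, map_mul, hπn]
    calc exp (-(2 * (n : ℤ))) * Valued.v (a * a + lam * a - W) ≤ exp (-(2 * (n : ℤ))) * exp (-2 : ℤ) :=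
          mul_le_mul_right hkey' _
      _ = exp (-(2 * (n : ℤ) + 2)) := by rw [← exp_add]; congr 1; ring

/-! ## §3 At the break: the graded norm map at level `d − 1` has image of index at most two — one fixed one-unit `c` covers the other coset -/

/-- **AT THE BREAK THE GRADED NORM MAP HAS INDEX `≤ 2`** (Serre V §3 Prop. 5 (iii)): in the ramified quadratic datum with `|2| < 1` and `d = n + 1 ≥ 2`, there is ONE `σ`-fixed `c`
with `|c − 1| < 1` such that every `σ`-fixed unit `w` with `|w − 1| ≤ exp(−2n)` admits `z` with `|z| = 1` and `|w − zσz| ≤ exp(−2d)` OR `|c·w − zσz| ≤ exp(−2d)`.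
Here `z = 1 + y·ϖⁿ` for a fixed integer `y` with `y² + λy ≡ W` resp. `≡ W + κ (mod 𝔪)` (`W = (w−1)∕πⁿ`, `λ = Tr(ϖⁿ)∕πⁿ`, `π = ϖσϖ`; `exists_fixed_residue_dichotomy`), and
`c = 1 + κ·πⁿ`. [cite: Serre1979, Ch. V §3 Prop. 5 (iii)] [cite: NeukirchANT1999, Ch. V (1.2)] -/
theorem exists_norm_approx_at_break [Finite 𝓀[K]] (hσ : ∀ x, σ (σ x) = x) (hvσ : ∀ a, Valued.v (σ a) = Valued.v a)
    (hfix : ∀ x : K, σ x = x → x ≠ 0 → ∃ n : ℤ, Valued.v x = exp (2 * n)) (hϖ : Valued.v ϖ = exp (-1 : ℤ))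
    (hd : Valued.v (ϖ - σ ϖ) = Valued.v ϖ ^ d) (ht : Valued.v (2 : K) = Valued.v ϖ ^ t) (h2v : Valued.v (2 : K) < 1)
    {n : ℕ} (hn : n + 1 = d) (hn1 : 1 ≤ n) :
    ∃ c : K, σ c = c ∧ Valued.v (c - 1) < 1 ∧ ∀ w : K, σ w = w → Valued.v w = 1 → Valued.v (w - 1) ≤ exp (-(2 * (n : ℤ))) →
      ∃ z : K, Valued.v z = 1 ∧
        (Valued.v (w - z * σ z) ≤ exp (-(2 * (n : ℤ) + 2)) ∨ Valued.v (c * w - z * σ z) ≤ exp (-(2 * (n : ℤ) + 2))) := by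
  have hϖ1 : exp (-1 : ℤ) < (1 : ℤᵐ⁰) := by rw [← exp_zero, exp_lt_exp]; norm_num
  -- `πⁿ`
  have hπn : Valued.v ((ϖ * σ ϖ) ^ n) = exp (-(2 * (n : ℤ))) := v_normVarpi_pow hvσ hϖ n
  have hπn0 : (ϖ * σ ϖ) ^ n ≠ 0 := (Valuation.ne_zero_iff _).1 (by rw [hπn]; exact exp_ne_zero)
  have hσπn : σ ((ϖ * σ ϖ) ^ n) = (ϖ * σ ϖ) ^ n := by rw [map_pow, map_mul_map hσ]
  have hπn1 : Valued.v ((ϖ * σ ϖ) ^ n) < 1 := by rw [hπn, ← exp_zero, exp_lt_exp]; omega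
  -- the trace term at the break: `|A| ≤ exp(−2n)` only
  have hA : Valued.v (ϖ ^ n + σ (ϖ ^ n)) ≤ exp (-(2 * (n : ℤ))) :=
    v_add_map_le_exp hσ hfix hϖ hd ht (x := ϖ ^ n) (j := n) (m := n)
      (by rw [map_pow, v_varpi_pow hϖ]) (by omega)
  have hσA : σ (ϖ ^ n + σ (ϖ ^ n)) = ϖ ^ n + σ (ϖ ^ n) := map_add_map_eq_self hσ _
  set lam : K := (ϖ ^ n + σ (ϖ ^ n)) / (ϖ * σ ϖ) ^ n with hlamdef
  have hσlam : σ lam = lam := by rw [hlamdef, map_div₀, hσA, hσπn]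
  have hlam1 : Valued.v lam ≤ 1 := by
    rw [hlamdef, map_div₀, hπn, div_le_iff₀ (by exact exp_pos), one_mul]; exact hA
  -- ONE `κ` for every `W`
  obtain ⟨κ, hσκ, hκ1, hdich⟩ := exists_fixed_residue_dichotomy hσ hfix hϖ hd h2v hlam1
  refine ⟨1 + κ * (ϖ * σ ϖ) ^ n, by rw [map_add, map_one, map_mul, hσκ, hσπn], ?_, fun w hσw hw1 hw => ?_⟩
  · rw [add_sub_cancel_left, map_mul]
    calc Valued.v κ * Valued.v ((ϖ * σ ϖ) ^ n) ≤ 1 * Valued.v ((ϖ * σ ϖ) ^ n) := mul_le_mul_left hκ1 _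
      _ < 1 := by rw [one_mul]; exact hπn1
  set W : K := (w - 1) / (ϖ * σ ϖ) ^ n with hWdef
  have hσW : σ W = W := by rw [hWdef, map_div₀, map_sub, map_one, hσw, hσπn]
  have hW1 : Valued.v W ≤ 1 := by
    rw [hWdef, map_div₀, hπn, div_le_iff₀ (by exact exp_pos), one_mul]; exact hw
  obtain ⟨a, hσa, ha1, hcase⟩ := hdich W hW1
  -- the two error identities
  have hdiff₁ : w - (1 + a * ϖ ^ n) * σ (1 + a * ϖ ^ n) = -((ϖ * σ ϖ) ^ n * (a * a + lam * a - W)) := by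
    rw [one_add_mul_mul_map hσa n, hlamdef, hWdef]
    field_simp
    ring
  have hdiff₂ : (1 + κ * (ϖ * σ ϖ) ^ n) * w - (1 + a * ϖ ^ n) * σ (1 + a * ϖ ^ n) =
      -((ϖ * σ ϖ) ^ n * (a * a + lam * a - (W + κ))) + κ * W * ((ϖ * σ ϖ) ^ n * (ϖ * σ ϖ) ^ n) := by
    rw [one_add_mul_mul_map hσa n, hlamdef]
    have hw' : w = 1 + W * (ϖ * σ ϖ) ^ n := by rw [hWdef, div_mul_cancel₀ _ hπn0]; ring
    rw [hw']
    field_simp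
    ring
  -- a fixed element of valuation `< 1` has valuation `≤ exp(−2)`
  have hsharp : ∀ e : K, σ e = e → Valued.v e < 1 → Valued.v ((ϖ * σ ϖ) ^ n * e) ≤ exp (-(2 * (n : ℤ) + 2)) := by
    intro e hσe he
    have he' : Valued.v e ≤ exp (-2 : ℤ) := by
      have := v_le_exp_of_fixed_of_v_lt hfix hσe (m := 0) (by rw [mul_zero, exp_zero]; exact he)
      simpa using this
    rw [map_mul, hπn]
    calc exp (-(2 * (n : ℤ))) * Valued.v e ≤ exp (-(2 * (n : ℤ))) * exp (-2 : ℤ) := mul_le_mul_right he' _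
      _ = exp (-(2 * (n : ℤ) + 2)) := by rw [← exp_add]; congr 1; ring
  have hlt1 : exp (-(2 * (n : ℤ) + 2)) < (1 : ℤᵐ⁰) := by rw [← exp_zero, exp_lt_exp]; omega
  rcases hcase with h | h
  · -- `y² + λy ≡ W`: `w` itself is reached
    have hσe : σ (a * a + lam * a - W) = a * a + lam * a - W := by
      rw [map_sub, map_add, map_mul, map_mul, hσa, hσlam, hσW]
    have hbound : Valued.v (w - (1 + a * ϖ ^ n) * σ (1 + a * ϖ ^ n)) ≤ exp (-(2 * (n : ℤ) + 2)) := by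
      rw [hdiff₁, Valuation.map_neg]; exact hsharp _ hσe h
    refine ⟨1 + a * ϖ ^ n, ?_, Or.inl hbound⟩
    apply v_eq_one_of_v_mul_map_eq_one hvσ
    rw [← hw1]
    apply Valuation.map_eq_of_sub_lt
    rw [← neg_sub, Valuation.map_neg, hw1]
    exact lt_of_le_of_lt hbound hlt1
  · -- `y² + λy ≡ W + κ`: `c·w` is reached
    have hσe : σ (a * a + lam * a - (W + κ)) = a * a + lam * a - (W + κ) := by
      rw [map_sub, map_add, map_add, map_mul, map_mul, hσa, hσlam, hσW, hσκ]
    have hcw1 : Valued.v ((1 + κ * (ϖ * σ ϖ) ^ n) * w) = 1 := by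
      rw [map_mul, hw1, mul_one]
      have hsub : Valued.v ((1 + κ * (ϖ * σ ϖ) ^ n) - 1) < Valued.v (1 : K) := by
        rw [Valued.v.map_one, add_sub_cancel_left, map_mul]
        calc Valued.v κ * Valued.v ((ϖ * σ ϖ) ^ n) ≤ 1 * Valued.v ((ϖ * σ ϖ) ^ n) := mul_le_mul_left hκ1 _
          _ < 1 := by rw [one_mul]; exact hπn1
      have h := Valuation.map_eq_of_sub_lt _ hsub
      rwa [Valued.v.map_one] at h
    have hbound : Valued.v ((1 + κ * (ϖ * σ ϖ) ^ n) * w - (1 + a * ϖ ^ n) * σ (1 + a * ϖ ^ n)) ≤ exp (-(2 * (n : ℤ) + 2)) := by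
      rw [hdiff₂]
      refine Valued.v.map_add_le (by rw [Valuation.map_neg]; exact hsharp _ hσe h) ?_
      rw [map_mul, map_mul, map_mul, hπn, ← exp_add]
      calc Valued.v κ * Valued.v W * exp (-(2 * (n : ℤ)) + -(2 * (n : ℤ))) ≤ 1 * 1 * exp (-(2 * (n : ℤ)) + -(2 * (n : ℤ))) :=
            mul_le_mul_left (mul_le_mul' hκ1 hW1) _
        _ ≤ exp (-(2 * (n : ℤ) + 2)) := by rw [one_mul, one_mul, exp_le_exp]; omega
    refine ⟨1 + a * ϖ ^ n, ?_, Or.inr hbound⟩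
    apply v_eq_one_of_v_mul_map_eq_one hvσ
    rw [← hcw1]
    apply Valuation.map_eq_of_sub_lt
    rw [← neg_sub, Valuation.map_neg, hcw1]
    exact lt_of_le_of_lt hbound hlt1

end Literature.NumberTheory.LocalFields.WildQuadraticDatum
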